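import Summits.FinalStateConjecture.FinalStateConjecture.Theses.ZeroEnergyKerrOrBomb

/-!
# Sketch (crux-ideate r2, ideator 5) — crux stmt-FinalStateConjecture-17838 `ErgoregionBombModT`

Two TRUE structural statements found while hunting levers (see NegativeNotesIdeator5.md L2, L3); neither
reaches the crux's `0 < ν` — they are recorded as typed Props for the planner (support for 17840 / 13896)
and for the lead provers of the shared rigidity item.  No card is filed on them.
-/

namespace Summit.FinalStateConjecture.FinalStateConjecture.Cruxes.ErgoregionBombModT.Ideator5

open Literature.Geometry.Lorentzian
open scoped Manifold Topology

/-- **L2 (causal density of stationary orbits).** Every event of the d.o.c. lies in the chronological future AND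
in the chronological past of the stationary orbit of every other event of the d.o.c.: `⟨⟨M_ext⟩⟩ ⊆ I⁺(Orbit{s}) ∩
I⁻(Orbit{s})` for all `s ∈ ⟨⟨M_ext⟩⟩`.  Consequences: no Killing orbit of the d.o.c. is achronal (so Galloway's
null-line splitting is void for hovering light lines), `∂I^±(Orbit γ) ∩ doc = ∅` for every trapped ray, and Killing
time is unbounded in both directions along a ray trapped mod `T`.  Proof sketch: `s ≪ q ∈ M_ext`; any two far orbits are
chronologically comparable after a finite shift (compactness of a path in the far slice region + openness of `≪` +
`T` future timelike on `M_ext`); `M_ext ∋ q' ≪ p`.  [folklore] -/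
def CausalDensityOfOrbits : Prop :=
  ∀ (𝓑 : StationaryAFBlackHole.{0}) [𝓑.metric.HasLeviCivita], ∀ s ∈ 𝓑.doc,
    𝓑.doc ⊆ 𝓑.metric.chronologicalFuture 𝓑.timeOrientation (stationaryOrbit 𝓑.killing {s}) ∧
    𝓑.doc ⊆ 𝓑.metric.chronologicalPast 𝓑.timeOrientation (stationaryOrbit 𝓑.killing {s})

/-- **L3 (orthogonal transitivity of the collar pair).** In the telescope of `ErgoregionBombModT` (vacuum, I⁺-regular,
future-presented, `T ≠ 0` on a simply connected d.o.c., Killing–timelike collar `(U, K)` on a connected horizon, belt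
compact mod `T`), on the connected component of `U` containing a horizon point, at every point where `T` and `K` are
linearly independent, the 2-planes orthogonal to `span{T, K}` are integrable: `g(∇_v T, w) = g(∇_v K, w) = 0` for all
`v, w ⊥ T, K` (equivalently the twist 4-forms `T♭∧K♭∧dT♭`, `T♭∧K♭∧dK♭` vanish).  Mechanism: in vacuum the two twist
scalars of a commuting Killing pair are locally constant (Carter 1969, Kundt–Trümper 1966; Wald Thm 7.1.1); `Z = K − T`
descends to the generator sphere `𝓗⁺/K ≅ S²` and vanishes on a pole generator (Poincaré–Hopf), where `T ∥ K` kills both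
scalars.  Consequence: the collar is locally Lewis–Papapetrou with timelike orbits, the reduced equations are the
ELLIPTIC Ernst system and the metric is real-analytic there in adapted charts — the hair of a telescope hole never starts
inside the collar (support for `HawkingExtensionIsKerr` / `NonTrappingHawkingRigidity`).
[cite: Wald1984, Thm. 7.1.1] -/
def CollarOrthogonalTransitivity : Prop :=
∀ (𝓑 : Literature.Geometry.Lorentzian.StationaryAFBlackHole.{0}) [𝓑.metric.HasLeviCivita] [Literature.Geometry.Lorentzian.Kerr.Facts], 𝓑.metric.toPseudoRiemannianMetric.IsRicciFlat → 𝓑.IsIPlusRegular → (∀ p : 𝓑.carrier, p ∈ 𝓑.metric.chronologicalFuture 𝓑.timeOrientation 𝓑.Mext) → (∀ p ∈ 𝓑.doc, 𝓑.killing p ≠ 0) → SimplyConnectedSpace 𝓑.doc → ∀ (U : Set 𝓑.carrier) (K : Π x : 𝓑.carrier, TangentSpace (𝓡 4) x), IsOpen U → 𝓑.horizon ⊆ U → IsConnected 𝓑.horizon → ContMDiffOn (𝓡 4) ((𝓡 4).prod 𝓘(ℝ, Literature.Geometry.Lorentzian.E4)) ((⊤ : ℕ∞) : WithTop ℕ∞)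 (fun x ↦ (Bundle.TotalSpace.mk' Literature.Geometry.Lorentzian.E4 x (K x) : TangentBundle (𝓡 4) 𝓑.carrier)) U → (∀ x ∈ U, ∀ v w : TangentSpace (𝓡 4) x, 𝓑.metric.val x (𝓑.metric.leviCivita K x v) w + 𝓑.metric.val x v (𝓑.metric.leviCivita K x w) = 0) → (∀ x ∈ U, VectorField.mlieBracket (𝓡 4) 𝓑.killing K x = 0) → (∀ p ∈ 𝓑.horizon, K p ≠ 0) → (∀ γ : ℝ → 𝓑.carrier, IsMIntegralCurve γ K → γ 0 ∈ 𝓑.horizon → ∀ t, γ t ∈ 𝓑.horizon) → (∀ x ∈ U ∩ 𝓑.doc, 𝓑.metric.val x (K x) (K x) < 0) → (∃ S₀ : Set 𝓑.carrier, IsCompact S₀ ∧ S₀ ⊆ 𝓑.doc ∧ ∀ y ∈ 𝓑.doc, 0 ≤ 𝓑.metric.val y (𝓑.killing y) (𝓑.killing y) → y ∉ U → y ∈ Literature.Geometry.Lorentzian.stationaryOrbit 𝓑.killing S₀) → ∀ p ∈ 𝓑.horizon, ∀ x ∈ connectedComponentIn U p, LinearIndependent ℝ ![𝓑.killing x, K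 x] →
    ∀ v w : TangentSpace (𝓡 4) x, 𝓑.metric.val x (𝓑.killing x) v = 0 → 𝓑.metric.val x (K x) v = 0 →
      𝓑.metric.val x (𝓑.killing x) w = 0 → 𝓑.metric.val x (K x) w = 0 →
      𝓑.metric.val x (𝓑.metric.leviCivita 𝓑.killing x v) w = 0 ∧ 𝓑.metric.val x (𝓑.metric.leviCivita K x v) w = 0

end Summit.FinalStateConjecture.FinalStateConjecture.Cruxes.ErgoregionBombModT.Ideator5
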